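import Literature.NumberTheory.GaloisRepresentations.IdeleProjectionS
import Literature.NumberTheory.GaloisRepresentations.IdeleBarKSMaps
import HarnessLib

/-!
# The idèle projections and the truncation: `π_v ∘ trunc = π_v` above `S` and at infinity, `= 0` off `S`; the
# (R2)_S input `π_v^S ∘ (E_{K_S} → I_S) = π_v ∘ (E_{K_S} → J̄)` (Harari, *Galois Cohomology and CFT*, Prop. 17.26)

Topic `NumberTheory/GaloisRepresentations`; namespace `Literature.NumberTheory.GaloisRepresentations.IdeleReadout`; sequel
to `IdeleProjectionS.lean` (`finIdelePiS`, `archIdelePiS`), `IdeleTruncationLimit.lean` (`truncBar`) and `IdeleBarKSMaps.lean`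
(`unitsToTruncKS : E_{K_S} → I_S`).  Theorems only; NO named fact, no `sorry`, no instance, no notation; number fields
in `Type`.

THE POINT.  Door-c6's readout datum `HomDual.IdeleProjection K v` asks of `π_v` two things: `res_v`-equivariance and
"`π_v` is `ι_v` on the principal idèles".  For the `S`-version the principal idèles enter `I_S` TRUNCATED
(`unitsToTruncKS = trunc ∘ unitsToIdele`), so the second axiom at `v ∈ S ∪ ∞` needs `π_v ∘ trunc = π_v` there; this file
proves it (and the vanishing off `S`), reducing the units axiom of the future `S`-readout datum to door-c6's
`finIdelePi_unitsToIdele` / `archIdelePi_unitsToIdele`.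

## What is formalised (`K : Type` a number field, `S : Finset (HeightOneSpectrum (𝓞 K))`)

* `finIdelePi_truncBar_of_mem` (`v ∈ S`: `π_v (trunc z) = π_v z`), `finIdelePi_truncBar_of_not_mem` (`v ∉ S`: `= 0`),
  `archIdelePi_truncBar` (infinite `v`: `π_v (trunc z) = π_v z`).
* **`finIdelePiS_unitsToTruncKS`** (`v ∈ S`) and **`archIdelePiS_unitsToTruncKS`**: `π_v^S ((E_{K_S} → I_S) u) =
  π_v ((E → J̄) u)` — with door-c6's `finIdelePi_unitsToIdele` / `archIdelePi_unitsToIdele` this is `ι_v` on units.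

Written for lane «PT-Ш-S-TC» (brick D3 / D4b) of crux `GoodLatticeBDPValue` (cell bsd-eis, item 19032), seat
bsd-line-x1-p1-w6 gen 10.  HONEST FRAMING: bookkeeping; no arithmetic statement and no case of BSD is proved here.

## References
* D. Harari, *Galois Cohomology and Class Field Theory*, Universitext, Springer (2020), Prop. 17.26 (proof), §17.4 (17.1).
  [Harari2020]
* J. S. Milne, *Arithmetic Duality Theorems*, 2nd ed. (2006), I Lemma 4.13 (proof). [MilneADT2006]
-/

noncomputable section

open NumberField IsDedekindDomain Field CategoryTheory
open Literature.NumberTheory.Automorphic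
open scoped Classical

namespace Literature.NumberTheory.GaloisRepresentations

namespace IdeleReadout

open SemiLocal DiscreteGaloisModule IdeleClassBar HomDual Literature.Algebra.Homology

variable (K : Type) [Field K] [NumberField K] (S : Finset (HeightOneSpectrum (𝓞 K)))

/-- **`π_v ∘ trunc = π_v` for `v ∈ S`**: the truncation keeps the components above `S`.
[cite: Harari2020, Prop. 17.26 (proof)] -/
theorem finIdelePi_truncBar_of_mem {v : HeightOneSpectrum (𝓞 K)} (hv : v ∈ S) (z : (ideleData K).toSystem.limit) :
    finIdelePi v (truncBar K S z) = finIdelePi v z := by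
  obtain ⟨E, x, rfl⟩ := (ideleData K).toSystem.exists_of z
  haveI := E.numberField
  haveI := E.isGalois
  rw [truncBar_of, finIdelePi_of, finIdelePi_of]
  apply unitsVal_injective
  apply Units.ext
  rw [coe_unitsVal_idelePlaceReadout, coe_unitsVal_idelePlaceReadout, toMul_truncHomData_app,
    IdeleHerbrand.truncOf_snd_apply, if_pos]
  have h2 := (embPlace v (layerEmb E) : Place K E.1 v).2
  convert hv using 1
  exact h2

/-- **`π_v ∘ trunc = 0` for `v ∉ S`** (the truncation kills the components off `S`).
[cite: Harari2020, Lemma 15.39, Prop. 17.26 (proof)] -/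
theorem finIdelePi_truncBar_of_not_mem {v : HeightOneSpectrum (𝓞 K)} (hv : v ∉ S) (z : (ideleData K).toSystem.limit) :
    finIdelePi v (truncBar K S z) = 0 := by
  obtain ⟨E, x, rfl⟩ := (ideleData K).toSystem.exists_of z
  haveI := E.numberField
  haveI := E.isGalois
  rw [truncBar_of, finIdelePi_of]
  apply unitsVal_injective
  apply Units.ext
  rw [coe_unitsVal_idelePlaceReadout, show unitsVal (v.adicCompletion K) 0 = 1 from rfl, Units.val_one,
    toMul_truncHomData_app, IdeleHerbrand.truncOf_snd_apply, if_neg, map_one]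
  exact fun h => hv (by
    have h2 := (embPlace v (layerEmb E) : Place K E.1 v).2
    convert h using 1
    exact h2.symm)

/-- **`π_v ∘ trunc = π_v` at an infinite place** (the truncation keeps the archimedean part).
[cite: Harari2020, Prop. 17.26 (proof)] -/
theorem archIdelePi_truncBar (v : InfinitePlace K) (z : (ideleData K).toSystem.limit) :
    archIdelePi v (truncBar K S z) = archIdelePi v z := by
  obtain ⟨E, x, rfl⟩ := (ideleData K).toSystem.exists_of z
  haveI := E.numberField
  haveI := E.isGalois
  rw [truncBar_of, archIdelePi_of, archIdelePi_of]
  apply unitsVal_injective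
  apply Units.ext
  rw [coe_unitsVal_ideleInfPlaceReadout, coe_unitsVal_ideleInfPlaceReadout, toMul_truncHomData_app,
    IdeleHerbrand.truncOf_fst]

/-- **(R2)_S input at `v ∈ S`: `π_v^S ((E_{K_S} → I_S) u) = π_v ((Eˣ → J̄) u)`** — so by door-c6's
`finIdelePi_unitsToIdele` the `S`-projection is `ι_v` on the truncated units. [cite: Harari2020, Prop. 17.26 (proof)] -/
theorem finIdelePiS_unitsToTruncKS {v : HeightOneSpectrum (𝓞 K)} (hv : v ∈ S) (u : (unitsBarKS K S).V) :
    finIdelePiS K S v (truncKSAddHom K S ((unitsToIdelesKS K S).hom u)) =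
      finIdelePi v ((unitsToIdele K).limitMap (u.1 : (unitsData K).toSystem.limit)) := by
  rw [finIdelePiS_apply, coe_truncKSAddHom_apply, coe_unitsToIdelesKS_apply, finIdelePi_truncBar_of_mem K S hv]

/-- **(R2)_S input at an infinite place: `π_v^S ((E_{K_S} → I_S) u) = π_v ((Eˣ → J̄) u)`.**
[cite: Harari2020, Prop. 17.26 (proof)] -/
theorem archIdelePiS_unitsToTruncKS (v : InfinitePlace K) (u : (unitsBarKS K S).V) :
    archIdelePiS K S v (truncKSAddHom K S ((unitsToIdelesKS K S).hom u)) =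
      archIdelePi v ((unitsToIdele K).limitMap (u.1 : (unitsData K).toSystem.limit)) := by
  rw [archIdelePiS_apply, coe_truncKSAddHom_apply, coe_unitsToIdelesKS_apply, archIdelePi_truncBar]

end IdeleReadout

end Literature.NumberTheory.GaloisRepresentations

end
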